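import Summits.QuantumFields.YangMills.Theorems.BalabanLadderUVSeamRecWeakWindowTwoPoint
import Summits.QuantumFields.YangMills.Theorems.BalabanLadderNTWeakPackage
import Summits.QuantumFields.YangMills.Theorems.LangevinControlUVOSLegsAtWeakCouplingCFblOfFbl6
import Summits.QuantumFields.YangMills.Theorems.OnsetSkewLawRPOnsetFloorCellShift
import HarnessLib

/-!
# Cruxes `OnsetSkewLaw.RPOnsetFloor` (stmt-QuantumFields-23138) and `MarkovAtoms.OnsetFloor` (stmt-QuantumFields-22956), LINES
# «FemtoWitness» (planner ym-idea-11 g14; skeletons v2 sha 958e4afc / sha a576d52f): the registered stub A `stub_femtoAtomicFloor` BY NAME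

Stub A (IDENTICAL text in both skeletons): the femto two-point package `(FBL6, FC2)` in a unit `a → 0` gives an ATOMIC torus floor
`AtomicTorusFloorAt G r` — an admissible collar bump `b`, ONE affine image `v = b(κ · − w)` and, for `β ≥ β₅`, the torus floor
`ε ≤ Q2(θv, v)` at the lattice resolution `s = a β`, with `κ s ≤ 1`, `κ s ≤ 2 w₀`, `R₀ + 1 + 10 κ s ≤ 2 w₀ + t`.  Following the planner's
plan `g14/stub-plans.md §A`: NO re-run of the femto floor — the tree's bump-as-parameter weak floor
`UVSeamRec.WeakWindow.twoPoint_floor_param_ratio_weak` fed by `DlrCollarTransfer.fbl_of_fbl6` and `NT.WeakPackage.floor_of_fc2` accepts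
ANY plateau bump fitting the femto ball; we supply a RADIAL plateau bump (§1, `Real.smoothTransition` of a quadratic in `‖u − p‖`),
whose unit-scale copy centred at `(3/2)·𝟙` is an admissible collar bump with `R₀ = 5/2`, `t = 3` (§2, radial ⇒ permutation and
time-reflection symmetric) and whose femto copy centred at `(s_f/2) e₀` with radius `s_f/4` is its affine image with `κ = 4/s_f`,
`w = 2e₀ − (3/2)𝟙` (§3); `a β < s_f/80` eventually gives the three smallness clauses (§4).  `stub_femtoAtomicFloor : StubFemtoAtomicP`
(registered text verbatim, `AtomicTorusFloorAt` copied verbatim, `AdmBump` the tree copy of `RPOnsetFloorCellShift`).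

HONEST FRAMING: glue stub of two OPEN lines whose content is the residual `SqueezedSkewness.FemtoTwoPointUnit` (stmt-QuantumFields-23679,
XL); no crux, rung or summit is proved; the Yang–Mills mass gap is NOT proved.  Cell `ym-idea-1`, width seat `ym-line-sfw-p2-w5` g16. [folklore]
-/

set_option autoImplicit false

noncomputable section

open scoped ContDiff
open MeasureTheory Filter Topology Metric
open Literature.MathematicalPhysics.QuantumFieldTheory Literature.MathematicalPhysics.QuantumLattice
open Summit.QuantumFields.YangMills.Cruxes.OSLegsFromFemtoAndGap.DlrCollarTransfer (Q2 FBL6 FC2 fbl_of_fbl6)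
open Summit.QuantumFields.YangMills.Theorems.RPOnsetFloorCellShift (AdmBump)

namespace Summit.QuantumFields.YangMills.Theorems.RPOnsetFloorFemtoAtomic

/-! ## §0 Registered texts (verbatim from the FemtoWitness skeletons; registered-stub copies, not citable facts) -/

/-- ATOMIC TORUS FLOOR for the datum `(G, r)` (verbatim the skeletons' `AtomicTorusFloorAt`). -/
abbrev AtomicTorusFloorAt (G : Type) [Group G] [TopologicalSpace G] [IsTopologicalGroup G] [CompactSpace G]
    [MeasurableSpace G] [BorelSpace G] (r : LatticeRep G) : Prop :=
  ∃ (b : SchwartzMap (EuclideanSpace ℝ (Fin 4)) ℝ) (R₀ t : ℝ), AdmBump b R₀ t ∧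
    ∃ (v : SchwartzMap (EuclideanSpace ℝ (Fin 4)) ℝ) (κ : ℝ) (w : EuclideanSpace ℝ (Fin 4)),
      0 < κ ∧ 0 ≤ w 0 ∧ (∀ u : EuclideanSpace ℝ (Fin 4), v u = b (κ • u - w)) ∧
      tsupport (v : EuclideanSpace ℝ (Fin 4) → ℝ) ⊆ {u : EuclideanSpace ℝ (Fin 4) | 0 < u 0} ∧
      ∃ (ε Λ₅ β₅ : ℝ), 0 < ε ∧ ∀ β : ℝ, β₅ ≤ β →
        ∃ s : ℝ, 0 < s ∧ κ * s ≤ 1 ∧ κ * s ≤ 2 * w 0 ∧ R₀ + 1 + 10 * (κ * s) ≤ 2 * w 0 + t ∧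
          ∀ L : ℕ, Λ₅ ≤ s * L → ε ≤ Q2 G r β L s (thetaTest 4 v) v

/-- STUB A statement (verbatim the skeletons' `StubFemtoAtomicP`). -/
abbrev StubFemtoAtomicP : Prop :=
  ∀ (G : Type) [Group G] [TopologicalSpace G] [IsTopologicalGroup G] [CompactSpace G],
    IsCompactSimpleLieGroup G →
    letI : MeasurableSpace G := borel G
    haveI : BorelSpace G := ⟨rfl⟩
    ∀ (r : LatticeRep G) (a : ℝ → ℝ), (∀ β, 0 < a β) → Tendsto a atTop (nhds 0) → FBL6 G r a → FC2 G r a →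
      AtomicTorusFloorAt G r

/-! ## §1 The radial plateau bump -/

/-- The radial plateau profile `u ↦ smoothTransition((ρ² − ‖u − p‖²)·4/(3ρ²))`: `= 1` on `dist ≤ ρ/2`, `= 0` off `ball p ρ`. -/
def radialFn (p : EuclideanSpace ℝ (Fin 4)) (ρ : ℝ) (u : EuclideanSpace ℝ (Fin 4)) : ℝ :=
  Real.smoothTransition ((ρ ^ 2 - ‖u - p‖ ^ 2) * (4 / (3 * ρ ^ 2)))

/-- Smoothness. [folklore] -/
theorem radialFn_contDiff (p : EuclideanSpace ℝ (Fin 4)) (ρ : ℝ) : ContDiff ℝ ∞ (radialFn p ρ) := by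
  unfold radialFn
  exact Real.smoothTransition.contDiff.comp
    ((contDiff_const.sub ((contDiff_norm_sq ℝ).comp (contDiff_id.sub contDiff_const))).mul contDiff_const)

/-- Nonnegativity. [folklore] -/
theorem radialFn_nonneg (p : EuclideanSpace ℝ (Fin 4)) (ρ : ℝ) (u : EuclideanSpace ℝ (Fin 4)) : 0 ≤ radialFn p ρ u :=
  Real.smoothTransition.nonneg _

/-- The plateau: `= 1` on `dist u p ≤ ρ/2`. [folklore] -/
theorem radialFn_eq_one {p : EuclideanSpace ℝ (Fin 4)} {ρ : ℝ} (hρ : 0 < ρ) {u : EuclideanSpace ℝ (Fin 4)}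
    (h : dist u p ≤ ρ / 2) : radialFn p ρ u = 1 := by
  unfold radialFn
  apply Real.smoothTransition.one_of_one_le
  rw [dist_eq_norm] at h
  have h2 : ‖u - p‖ ^ 2 ≤ (ρ / 2) ^ 2 := pow_le_pow_left₀ (norm_nonneg _) h 2
  have h3 : (ρ ^ 2 - ‖u - p‖ ^ 2) * (4 / (3 * ρ ^ 2)) = ((ρ ^ 2 - ‖u - p‖ ^ 2) * 4) / (3 * ρ ^ 2) := by ring
  rw [h3, le_div_iff₀ (by positivity)]
  nlinarith


/-- Off the ball the profile vanishes. [folklore] -/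
theorem radialFn_eq_zero {p : EuclideanSpace ℝ (Fin 4)} {ρ : ℝ} (hρ : 0 < ρ) {u : EuclideanSpace ℝ (Fin 4)}
    (h : ρ ≤ dist u p) : radialFn p ρ u = 0 := by
  unfold radialFn
  apply Real.smoothTransition.zero_of_nonpos
  rw [dist_eq_norm] at h
  have h2 : ρ ^ 2 ≤ ‖u - p‖ ^ 2 := pow_le_pow_left₀ hρ.le h 2
  exact mul_nonpos_of_nonpos_of_nonneg (by linarith) (by positivity)

/-- Support inside the open ball. [folklore] -/
theorem dist_lt_of_radialFn_ne_zero {p : EuclideanSpace ℝ (Fin 4)} {ρ : ℝ} (hρ : 0 < ρ) {u : EuclideanSpace ℝ (Fin 4)}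
    (h : radialFn p ρ u ≠ 0) : dist u p < ρ := by
  by_contra hle
  exact h (radialFn_eq_zero hρ (not_lt.1 hle))

/-- Compact support. [folklore] -/
theorem radialFn_hasCompactSupport (p : EuclideanSpace ℝ (Fin 4)) {ρ : ℝ} (hρ : 0 < ρ) :
    HasCompactSupport (radialFn p ρ) := by
  refine HasCompactSupport.intro (isCompact_closedBall p ρ) fun u hu => ?_
  by_contra h
  exact hu (mem_closedBall.2 (dist_lt_of_radialFn_ne_zero hρ h).le)

/-- The radial plateau bump as a Schwartz map. -/
def radialBump (p : EuclideanSpace ℝ (Fin 4)) (ρ : ℝ) (hρ : 0 < ρ) : SchwartzMap (EuclideanSpace ℝ (Fin 4)) ℝ :=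
  (radialFn_hasCompactSupport p hρ).toSchwartzMap (radialFn_contDiff p ρ)

/-- Evaluation. [folklore] -/
theorem radialBump_apply (p : EuclideanSpace ℝ (Fin 4)) {ρ : ℝ} (hρ : 0 < ρ) (u : EuclideanSpace ℝ (Fin 4)) :
    radialBump p ρ hρ u = radialFn p ρ u := rfl

/-- `tsupport` inside the closed ball. [folklore] -/
theorem tsupport_radialBump_subset (p : EuclideanSpace ℝ (Fin 4)) {ρ : ℝ} (hρ : 0 < ρ) :
    tsupport (radialBump p ρ hρ : EuclideanSpace ℝ (Fin 4) → ℝ) ⊆ closedBall p ρ := by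
  refine closure_minimal (fun u hu => ?_) isClosed_closedBall
  exact mem_closedBall.2 (dist_lt_of_radialFn_ne_zero hρ (Function.mem_support.1 hu)).le

/-! ## §2 The canonical radial admissible collar bump: centre `(3/2)·𝟙`, radius `1`, `R₀ = 5/2`, `t = 3` -/

/-- The centre `(3/2)·𝟙`. -/
def centre : EuclideanSpace ℝ (Fin 4) := WithLp.toLp 2 fun _ => (3 / 2 : ℝ)

/-- The admissible radial bump `b₁`. -/
def b₁ : SchwartzMap (EuclideanSpace ℝ (Fin 4)) ℝ := radialBump centre 1 one_pos

/-- Coordinates on `tsupport b₁` lie in `[1/2, 5/2]`. [folklore] -/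
theorem coord_mem_of_mem_tsupport {u : EuclideanSpace ℝ (Fin 4)} (hu : u ∈ tsupport (b₁ : EuclideanSpace ℝ (Fin 4) → ℝ))
    (j : Fin 4) : 1 / 2 ≤ u j ∧ u j ≤ 5 / 2 := by
  have h := tsupport_radialBump_subset centre one_pos hu
  rw [mem_closedBall, dist_eq_norm] at h
  have hj : |u j - 3 / 2| ≤ 1 := by
    have h1 := PiLp.norm_apply_le (u - centre) j
    rw [Real.norm_eq_abs, PiLp.sub_apply] at h1
    have hc : centre j = 3 / 2 := rfl
    rw [hc] at h1
    exact h1.trans h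
  constructor <;> linarith [(abs_le.1 hj).1, (abs_le.1 hj).2]

/-- **`b₁` is an admissible collar bump with `R₀ = 5/2`, `t = 3`.** [folklore] -/
theorem admBump_b₁ : AdmBump b₁ (5 / 2) 3 := by
  refine ⟨radialFn_hasCompactSupport centre one_pos, fun u hu j => ?_, fun u hu => ?_, ?_, fun π u => ?_, fun u => ?_⟩
  · obtain ⟨h1, h2⟩ := coord_mem_of_mem_tsupport hu j
    exact ⟨by linarith, h2⟩
  · have := (coord_mem_of_mem_tsupport hu 0).1
    show 0 < u 0
    linarith
  · have hc : (b₁ : EuclideanSpace ℝ (Fin 4) → ℝ) centre ≠ 0 := by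
      show radialFn centre 1 centre ≠ 0
      rw [radialFn_eq_one one_pos (by simp)]
      exact one_ne_zero
    exact ((SchwartzMap.continuous b₁).integral_pos_of_hasCompactSupport_nonneg_nonzero
      (radialFn_hasCompactSupport centre one_pos) (fun u => radialFn_nonneg centre 1 u) hc).ne'
  · show radialFn centre 1 _ = radialFn centre 1 u
    have hn : ‖(WithLp.toLp 2 fun i => u (π i)) - centre‖ = ‖u - centre‖ := by
      rw [EuclideanSpace.norm_eq, EuclideanSpace.norm_eq]
      congr 1
      have h : ∀ i : Fin 4, ‖((WithLp.toLp 2 fun i => u (π i)) - centre) i‖ ^ 2 = ‖u (π i) - 3 / 2‖ ^ 2 :=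
        fun i => rfl
      have h' : ∀ i : Fin 4, ‖(u - centre) i‖ ^ 2 = ‖u i - 3 / 2‖ ^ 2 := fun i => rfl
      simp only [h, h']
      exact Equiv.sum_comp π (fun i => ‖u i - 3 / 2‖ ^ 2)
    unfold radialFn
    rw [hn]
  · show radialFn centre 1 _ = radialFn centre 1 u
    have hn : ‖(WithLp.toLp 2 fun i => if i = 0 then 3 - u i else u i) - centre‖ = ‖u - centre‖ := by
      rw [EuclideanSpace.norm_eq, EuclideanSpace.norm_eq]
      congr 1
      refine Finset.sum_congr rfl fun i _ => ?_
      have h : ((WithLp.toLp 2 fun i => if i = 0 then 3 - u i else u i) - centre) i =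
          (if i = 0 then 3 - u i else u i) - 3 / 2 := rfl
      have h' : (u - centre) i = u i - 3 / 2 := rfl
      rw [h, h']
      split_ifs with hi
      · rw [Real.norm_eq_abs, Real.norm_eq_abs, show (3 : ℝ) - u i - 3 / 2 = -(u i - 3 / 2) by ring, abs_neg]
      · rfl
    unfold radialFn
    rw [hn]

/-! ## §3 The femto copy is an affine image of `b₁` -/

/-- The femto copy `v = radialBump ((s/2) e₀) (s/4)` is the affine image `b₁((4/s) • u − w)` with `w = 2e₀ − (3/2)𝟙`. [folklore] -/
theorem femto_copy_eq {s : ℝ} (hs : 0 < s) (u : EuclideanSpace ℝ (Fin 4)) :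
    radialBump ((s / 2) • EuclideanSpace.single (0 : Fin 4) (1 : ℝ)) (s / 4) (by positivity) u =
      b₁ ((4 / s) • u - ((2 : ℝ) • EuclideanSpace.single (0 : Fin 4) (1 : ℝ) - centre)) := by
  show radialFn _ (s / 4) u = radialFn centre 1 _
  unfold radialFn
  congr 1
  have hvec : (4 / s) • u - ((2 : ℝ) • EuclideanSpace.single (0 : Fin 4) (1 : ℝ) - centre) - centre =
      (4 / s) • (u - (s / 2) • EuclideanSpace.single (0 : Fin 4) (1 : ℝ)) := by
    rw [smul_sub, smul_smul, show (4 / s) * (s / 2) = 2 by field_simp; ring]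
    abel
  rw [hvec, norm_smul, Real.norm_eq_abs, abs_of_pos (by positivity), mul_pow, one_pow]
  field_simp

/-! ## §4 Stub A for every compact `G` -/

/-- **Femto two-point package ⇒ atomic torus floor**, for every compact `G` with its Borel structure. [folklore] -/
theorem femtoAtomicFloor_core {G : Type} [Group G] [TopologicalSpace G] [IsTopologicalGroup G] [CompactSpace G]
    [MeasurableSpace G] [BorelSpace G] (r : LatticeRep G) (a : ℝ → ℝ) (ha : ∀ β, 0 < a β)
    (ha0 : Tendsto a atTop (nhds 0)) (hFBL6 : FBL6 G r a) (hFC2 : FC2 G r a) : AtomicTorusFloorAt G r := by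
  obtain ⟨sf, ε, β₅, Λ₅, hsf, hε, H⟩ :=
    Summit.QuantumFields.YangMills.Cruxes.UVSeamRec.WeakWindow.twoPoint_floor_param_ratio_weak G r a one_pos ha ha0
      (fbl_of_fbl6 r a hFBL6) (Summit.QuantumFields.YangMills.Cruxes.NT.WeakPackage.floor_of_fc2 G r a hFC2)
  -- the femto copy of the radial bump
  have hρ : 0 < sf / 4 := by positivity
  set p : EuclideanSpace ℝ (Fin 4) := (sf / 2) • EuclideanSpace.single (0 : Fin 4) (1 : ℝ) with hp
  set v : SchwartzMap (EuclideanSpace ℝ (Fin 4)) ℝ := radialBump p (sf / 4) hρ with hv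
  have hpsingle : p = EuclideanSpace.single (0 : Fin 4) (sf / 2) := by
    rw [hp]; ext i; simp [PiLp.single_apply]
  have hv0 : ∀ z, 0 ≤ v z := fun z => radialFn_nonneg _ _ z
  have hv1 : ∀ z, dist z (EuclideanSpace.single 0 (sf / 2)) ≤ sf / 8 → v z = 1 := fun z hz =>
    radialFn_eq_one hρ (by rw [hpsingle]; linarith)
  have hv2 : ∀ z, v z ≠ 0 → dist z (EuclideanSpace.single 0 (sf / 2)) < 2 * (sf / 8) := fun z hz => by
    have h := dist_lt_of_radialFn_ne_zero hρ hz
    rw [hpsingle] at h; linarith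
  -- eventual smallness of the lattice spacing
  have hev : ∀ᶠ β in atTop, a β < sf / 80 := ha0.eventually (Iio_mem_nhds (by positivity))
  obtain ⟨β₆, hβ₆⟩ := Filter.eventually_atTop.1 hev
  refine ⟨b₁, 5 / 2, 3, admBump_b₁, v, 4 / sf, (2 : ℝ) • EuclideanSpace.single (0 : Fin 4) (1 : ℝ) - centre,
    by positivity, ?_, fun u => femto_copy_eq hsf u, ?_, ε, Λ₅, max β₅ β₆, hε, fun β hβ => ?_⟩
  · -- `w 0 = 1/2`
    simp [centre]
    norm_num
  · -- positive time
    intro u hu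
    have h := tsupport_radialBump_subset p hρ hu
    rw [mem_closedBall, dist_eq_norm] at h
    have h1 := PiLp.norm_apply_le (u - p) 0
    rw [Real.norm_eq_abs, PiLp.sub_apply] at h1
    have hp0 : p 0 = sf / 2 := by rw [hpsingle]; simp
    rw [hp0] at h1
    show 0 < u 0
    linarith [(abs_le.1 (h1.trans h)).1]
  · have hβ₅ : β₅ ≤ β := (le_max_left _ _).trans hβ
    have haβ : a β < sf / 80 := hβ₆ β ((le_max_right _ _).trans hβ)
    have hκs : 4 / sf * a β < 1 / 20 := by
      rw [div_mul_eq_mul_div, div_lt_iff₀ hsf]; linarith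
    have hw0 : ((2 : ℝ) • EuclideanSpace.single (0 : Fin 4) (1 : ℝ) - centre) 0 = 1 / 2 := by
      simp [centre]; norm_num
    refine ⟨a β, ha β, by linarith, by rw [hw0]; linarith, by rw [hw0]; linarith, fun L hL => ?_⟩
    exact H sf ⟨by rw [one_mul], le_rfl⟩ v hv0 hv1 hv2 β hβ₅ L hL

/-- **Stub A `stub_femtoAtomicFloor` of the FemtoWitness lines, BY NAME** (the simple-group hypothesis is idle). [folklore] -/
theorem stub_femtoAtomicFloor : StubFemtoAtomicP := by
  intro G _ _ _ _ _hG
  letI : MeasurableSpace G := borel G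
  haveI : BorelSpace G := ⟨rfl⟩
  intro r a ha ha0 h6 h2
  exact femtoAtomicFloor_core r a ha ha0 h6 h2

end Summit.QuantumFields.YangMills.Theorems.RPOnsetFloorFemtoAtomic

end
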